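import Summits.QuantumFields.YangMills.Theorems.UnitScaleTiltProp7SectET3N06LeavesRecordCut
import Summits.QuantumFields.YangMills.Theorems.UnitScaleTiltProp7SectET3GeometryFam
import HarnessLib

/-!
# Route `UnitScaleTilt` (α), node N06(d = 3) — **THE RE-CUT T³ LEAF OF RECORD ALONG AN ARBITRARY SUB-FAMILY `π : J → KIdx 2 ℓ hd3 hL b₀ b₁`**: ym-inputs-p04 g2's
# `Prop7SectET3N06LeavesRecordCut.t313_of_pins_T3_completePairMBZc` (Theorem 3.13 as the whole printed leaf, print's letter species) with every displayed row read over
# `x : J` at `geo9K (π x)` ∕ `bgT3 (π x)` and the conclusion `B9.Thm313Printed c35 (geo9K ∘ π) (bgT3 ∘ π) …` — the second brick of the «record re-cut over `{i // 1 ≤ i.m}`»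

Cell `ym-inputs` (D-0154 (2); desk `ym-inputs-plan-1` INPUT-LIST §4 row p05; HANDOFF §§ ym-inputs-p05 g2∕g3∕g4 item (2); memo `pub/ym-inputs/L0F-DEF-DESIGN-p05g2.md` §2 (A)),
seat ym-inputs-p05 g5.  Count-neutral helper (`--supports stmt-QuantumFields-20520 --as helper`); registry untouched; THEOREMS ONLY (0 `def`, 0 `sorry`); NOTHING of
[Balaban1985BackgroundPropagators] is asserted.

WHY (HANDOFF §§ p05 g3∕g4, desk WORD 5 2026-08-28T13:50:20Z «K1 … BLOCKED on the `{i ∕∕ 1 ≤ i.m}` record re-cut»).  The letter record `Prop7SectET3OpsT3.opsT3` is the pinned record on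
`1 ≤ i.m` and the ZERO record off it (no `T3Family` has `m = 0`), while the leaf of record displays `∀ i : KIdx 2 ℓ hd3 hL b₀ b₁`-rows (`hmodel`'s `Identities`, `hletters`, …) whose
premises (`M₁ ≤ (geo9K i).M`, (3.35)–(3.36)) are satisfiable at the junk indices: the leaf cannot be instantiated at `opsT3` as typed.  Track A's Literature leaf
`thm313Printed_completePairMBZc` is generic in the index type; only the T³ port fixed `KIdx`.  THIS FILE re-reads the port along ANY map `π : J → KIdx 2 ℓ hd3 hL b₀ b₁`:
★★★ `t313_of_pins_completePairMBZc_fam π` — the statement of `t313_of_pins_T3_completePairMBZc` with EXACTLY these changes: every binder `i : KIdx 2 ℓ hd3 hL b₀ b₁` becomes `i : J`,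
every `geo9K i` ∕ `bgT3 i` ∕ `RelB i` ∕ `geoOK_geo9K i` becomes `geo9K (π i)` ∕ `bgT3 (π i)` ∕ `RelB (π i)` ∕ `geoOK_geo9K (π i)` (carriers `X Y Z W PX PY : J → Type`, side predicate
`H₀ : J → Prop`), and the conclusion is `B9.Thm313Printed c35 (fun i ↦ geo9K (π i)) (fun i ↦ bgT3 (π i)) GG HasRWExp PosDefK`; the instance binders stay the whole family's.  The
original is the `π := id` reading (untouched, additive); the record instantiation (K1) uses `π := (·.1)` on `{i : KIdx 2 ℓ hd3 hL 1 1 // 1 ≤ i.m}`, where `opsT3` is genuine everywhere.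
PROOF: p04 g2's floor argument VERBATIM over the floor subtype `{i : J // M⋆ ≤ (geo9K (π i)).M}` — `thm313Printed_of_floor` (index-generic), the sub-family rows
`Prop7SectET3GeometryFam.hnbr_geo9K_floor_fam ∕ lemma21AboveG_geo9K_fam ∕ hCL_geo9K_floor_fam`, the whole family's `rowSum261_geo9K` read at `π j`, and the pointwise geometry
facts `geoOK_geo9K ∕ modelSignsOn_geo9K ∕ geo9K_one_le_L ∕ geo9K_L_le ∕ geo9K_eta_pos ∕ maj342_relB_* ∕ card_filter_relB_le ∕ dist_eq_of_relB` at `π j`.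
L-FLOOR (RULING g26-№20): none beyond the parent's.  HONEST SCOPE: a re-indexing of a by-name port; every analytic row stays a displayed HYPOTHESIS about the genuine operators;
N06(d = 3) NOT discharged; nothing here claims EX, the crux, V3∕R3, d = 4 or the mass gap; YM₃ on T³ = ladder rung R3 (RECORD), not the Clay problem.

References: T. Bałaban, CMP **99** (1985) 389–434 [Balaban1985BackgroundPropagators]; CMP **96** (1984) 223–250 [Balaban1984PropagatorsII].
-/

set_option autoImplicit false

noncomputable section

open scoped Matrix.Norms.L2Operator

namespace Summit.QuantumFields.YangMills.Theorems.Prop7SectET3N06LeavesRecordCutFam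


open Literature.MathematicalPhysics.QuantumFieldTheory.Balaban1983to89
open Finset B6RandomWalk B6RandomWalkHom B9Thm34Ext B9Thm37GlueCor36 B11SectG B9SectDSup B9Thm37AllNorms
open B9Thm37AllNormsInstances B9FromB6 B9FromB6ModelSignsOn B9SectBStepWhole B9Thm312Whole B9Thm312WholeLeaf B9Thm312WholeLeft B9Thm313Whole
open B9Thm313WholeLeft B9Thm312WholeLeafLeftGlob B9Ineq347CoReading B9SectCDiffDict B9CoRealizesRel B9Thm37Glue B9SectDL2Decay B9RWSums343Holder
open B9RWSumsReadsRel B9RWSumsReadsNbr B9Ineq347 B9Thm312WholeClasses B9Thm312WholeL2 B9Thm312WholeBlocksRel B9Thm312WholeBlocksNbr B9Thm313WholeLeafRel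
open B9Thm312WholeHolder B9Thm312WholeHHolder B9Thm313WholeHolder B9Thm313WholeL2G B9Thm313WholeL2GP B9Thm313WholeInput B9Thm313WholeBlocksNbr B9Thm312WholeLeafAll
open B9RWSums346SecondDiff B9Thm313WholeBlocksNbrRec B9RWSums344InputFam B9Thm312WholeDir B9Thm312WholeBlocksPairM B9Thm313WholeDir B9Thm313WholeDirInput B9Thm313WholeBlocksPairM
open B9Thm313WholeLeafCompletePairM B9Thm312WholeDirB B9Thm313WholeDirInputB B9Thm313WholeBlocksPairMB B9Thm313WholeLeafCompletePairMB B9Thm313WholeBlocksPairMZ B9Thm313WholeBlocksPairMBZ B9Thm313WholeLeafRelZ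
open B9Thm312WholeHZ B9Thm313WholeZ B9Thm313WholeLeftZ B9Thm313WholeHolderZ B9Thm313WholeInputZ B9Thm313WholeDirZ B9Thm313WholeDirInputZ B9Thm313WholeDirInputBZ
open B9Thm313WholeL2GZ B9Thm313WholeL2GPZ B9Thm313WholeDirL2Z B9Thm313WholeLeafCompletePairMBZ
open B9Thm313WholeRgdFrom3152 (Ids3152)
open B9Thm313WholeLettersCut (Letters313Zc Letters313HZc Letters313L2Pc)
open B9Thm313WholeLeafCompletePairMBZCut (thm313Printed_completePairMBZc)
open B6KLevelCensusIndexV1 (KIdx)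
open B9GeoNormsKLevelV1 (geo9K)
open B9CoRealizesRelAtLetters (RelB maj342_relB_left maj342_relB_right dist_eq_of_relB relB_refl)
open B9GeoLemma21KLevelV1 (rowSum261_geo9K geo9K_one_le_L geo9K_eta_pos)
open B9GeoNormsKLevelModelSignsV1 (modelSignsOn_geo9K)
open Summit.QuantumFields.YangMills.Theorems.Prop7SectET3Members (hd3)
open Summit.QuantumFields.YangMills.Theorems.Prop7SectET3Geometry (geoOK_geo9K geo9K_L_le)
open Summit.QuantumFields.YangMills.Theorems.Prop7SectET3BgClass (bgT3)
open Summit.QuantumFields.YangMills.Theorems.Prop7SectET3N06LeavesRelZ (card_filter_relB_le)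
open Summit.QuantumFields.YangMills.Theorems.Prop7SectET3Floor (thm313Printed_of_floor)
open Summit.QuantumFields.YangMills.Theorems.Prop7SectET3GeometryFam (lemma21AboveG_geo9K_fam hnbr_geo9K_floor_fam hCL_geo9K_floor_fam)


variable {ℓ : ℕ} {hL : Odd (ℓ + 1) ∧ 1 < ℓ + 1} {b₀ b₁ : ℝ} {c35 : ℝ} {J : Type} (π : J → KIdx 2 ℓ hd3 hL b₀ b₁)

/-- ★★★ **THEOREM 3.13 AS THE WHOLE PRINTED LEAF, RE-CUT TO PRINT'S LETTER SPECIES, READ ALONG A SUB-FAMILY `π : J → KIdx 2 ℓ hd3 hL b₀ b₁`** (statement of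
`Prop7SectET3N06LeavesRecordCut.t313_of_pins_T3_completePairMBZc` with `i : J`, `geo9K (π i)`, `bgT3 (π i)`, `RelB (π i)`, `geoOK_geo9K (π i)` throughout).  DISPLAYED VERBATIM as
in the parent — `𝔬`, `𝔭`, `bH ∕ bHX ∕ bHW`, `Gp`, `bXH`, `Dd ∕ Dds`, the co-readings `hcoR hco1R hcoG hl2N hH1N hIF`, `hsymGG`, `hmodel` (Thm 3.3 for G₀ = the XL item, Steps,
FormSmall, Identities), `hleft`, `hletters` (`Letters313Zc`), `h152` ((3.152) by name), `hlettersD`, `hG0C`, `hstepD`, `hLHH`, `hLH3` (`Letters313HZc`), `hG0L2`, `hstepL2`,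
`hLL2` (`Letters313L2Pc ∧ Letters313L2MZ`), `hLIM`, the numerics; DISCHARGED HERE exactly as in the parent (at `π j`): `GeoOK`, model signs, `1 ≤ L ≤ ℓ+1`, `0 < η`, the row sum
(2.61), `Lemma21AboveG`, the neighbour count and the length comparison ABOVE A FLOOR (`thm313Printed_of_floor`), `RelB`'s rows.  Conclusion:
`B9.Thm313Printed c35 (fun i ↦ geo9K (π i)) (fun i ↦ bgT3 (π i)) GG HasRWExp PosDefK`.  Nothing of print asserted; NOT a discharge of N06(d = 3).
[cite: Balaban1985BackgroundPropagators, Thm 3.13 p.426, Thm 3.12 p.423, (3.39)-(3.47) pp.397-398, (3.126) p.420, (3.132) p.422, (3.147)-(3.153) pp.425-426; Balaban1984PropagatorsII, (2.3) p.224, (2.45)-(2.46) p.231, (2.51)-(2.52) p.232, Lemma 2.1 (2.59)-(2.61) pp.233-234] -/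
theorem t313_of_pins_completePairMBZc_fam [∀ i : KIdx 2 ℓ hd3 hL b₀ b₁, Fintype (geo9K i).Site] [∀ i : KIdx 2 ℓ hd3 hL b₀ b₁, DecidableEq (geo9K i).Site]
    {X Y Z W PX PY : J → Type} {P : Type} [∀ i, Fintype (X i)] [∀ i, DecidableEq (X i)] [∀ i, Fintype (Y i)]
    [∀ i, Fintype (Z i)] [∀ i, Fintype (W i)] [∀ i, Fintype (PX i)] [∀ i, Fintype (PY i)] [Fintype P]
    (𝔬 : ∀ i : J, Ops (geo9K (π i)) (bgT3 (π i)) (X i) (Y i) (Z i) (W i)) (H₀ : J → Prop)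
    (GG : ∀ i : J, B9.KernelFamily (geo9K (π i)) (bgT3 (π i))) (bH : ∀ i : J, BlockNorm (toB6 (geo9K (π i)) 1 (H₀ i)) (W i → ℝ))
    (𝔭 : ∀ i : J, HolderProbes (geo9K (π i)) (bgT3 (π i)) (X i) (Y i) (PX i) (PY i))
    (bHX : ∀ i : J, ℝ → BlockNorm (toB6 (geo9K (π i)) 1 (H₀ i)) (X i → ℝ))
    (Gp : ∀ i : J, (bgT3 (π i)).Cfg → Module.End ℝ (W i → ℝ))
    (bXH : ∀ i : J, BlockNorm (toB6 (geo9K (π i)) 1 (H₀ i)) (X i → ℝ))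
    (Dd Dds : ∀ i : J, (bgT3 (π i)).Cfg → P → Module.End ℝ (X i → ℝ))
    (bHW : ∀ i : J, ℝ → BlockNorm (toB6 (geo9K (π i)) 1 (H₀ i)) (W i → ℝ))
    (ev : ∀ i : J, (geo9K (π i)).Loc → X i → ℝ) (evY : ∀ i : J, (geo9K (π i)).Loc → Y i → ℝ)
    (r Cev θ₁ θD θ₂ r₁ B₀ B₂ B₄ δ₀ δK σ ρ a₁ M₁ B₃ δ₃ ρ' α κ₀ : ℝ) (Bh Bi Bq BhD Bx Bd θH θI θV Br : ℝ → ℝ)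
    (Bi2 Bd2 : ℝ → ℝ → ℝ)
    (hθ₁ : 0 ≤ θ₁) (hθD : 0 ≤ θD) (hθH : ∀ β, 0 ≤ β → β < 1 → 0 ≤ θH β) (hθI : ∀ ε, 0 < ε → 0 ≤ θI ε) (hθ₂ : 0 ≤ θ₂)
    (hθV : ∀ ε, 0 < ε → 0 ≤ θV ε) (hr₁ : 0 ≤ r₁) (hB₀ : 0 ≤ B₀) (hB₂ : 0 ≤ B₂)
    (hB₃ : 0 ≤ B₃) (hB₄ : 0 ≤ B₄) (hBr : ∀ ε, 0 < ε → 0 ≤ Br ε) (hσ : 0 < σ) (hρ' : 0 < ρ') (hρ'ρ : ρ' + 3 * σ ≤ ρ) (hρ'ρ₅ : ρ' + 5 * σ ≤ ρ)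
    (hσρ' : 3 * σ < (1 - α) * ρ')
    (hρS : ρ ≤ δ₀) (hρ₃ : ρ ≤ δ₃) (hρδ : ρ + σ ≤ δK) (ha₁ : 0 < a₁) (hM₁ : 0 < M₁)
    (hα0 : 0 < α) (hα1 : α < 1) (hBi : ∀ ε, 0 < ε → ε ≤ 1 → 0 ≤ Bi ε) (hBd : ∀ ε, 0 < ε → ε ≤ 1 → 0 ≤ Bd ε)
    (hBi2 : ∀ ε β, 0 < ε → ε ≤ 1 → 0 ≤ β → β < 1 → 0 ≤ Bi2 ε β) (hBd2 : ∀ ε β, 0 < ε → ε ≤ 1 → 0 ≤ β → β < 1 → 0 ≤ Bd2 ε β)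
    (hBh : ∀ β, 0 ≤ β → β < 1 → 0 ≤ Bh β) (hBq : ∀ β, 0 ≤ β → β < 1 → 0 ≤ Bq β) (hBhD : ∀ β, 0 ≤ β → β < 1 → 0 ≤ BhD β)
    (hBx : ∀ β, 0 ≤ β → β < 1 → 0 ≤ Bx β) (hCev : 0 ≤ Cev)
    (hκ : ∀ i : J, (bH i).κ ≤ κ₀)
    (hκW : ∀ (i : J) (ε : ℝ), (bHW i ε).κ ≤ κ₀)
    (hκX : ∀ i : J, (bXH i).κ ≤ κ₀)
    (hcoR : ∀ (i : J) (U : (bgT3 (π i)).Cfg),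
      CoRealizesRel (GG i) 0 U (RelB (π i)) (𝔬 i).blk (𝔬 i).blk (ev i) ((𝔬 i).GG U) ∧
      CoRealizesRel (GG i) 2 U (RelB (π i)) (𝔬 i).blk (𝔬 i).blkY (evY i) ((𝔬 i).GG U ∘ₗ (𝔬 i).Dstar U))
    (hco1R : ∀ (i : J) (U : (bgT3 (π i)).Cfg), CoRealizesRel (GG i) 1 U (RelB (π i)) (𝔬 i).blkY (𝔬 i).blk (ev i) ((𝔬 i).D U ∘ₗ (𝔬 i).GG U))
    (hcoG : ∀ (i : J) (U : (bgT3 (π i)).Cfg),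
      CoReadsGlob (GG i) 0 U (𝔬 i).blk (𝔬 i).blk (ev i) ((𝔬 i).GG U) ∧
      CoReadsGlob (GG i) 1 U (𝔬 i).blkY (𝔬 i).blk (ev i) ((𝔬 i).D U ∘ₗ (𝔬 i).GG U) ∧
      CoReadsGlob (GG i) 2 U (𝔬 i).blk (𝔬 i).blkY (evY i) ((𝔬 i).GG U ∘ₗ (𝔬 i).Dstar U))
    (hsymGG : ∀ i : J, M₁ ≤ (geo9K (π i)).M → ∀ α₀ : ℝ, 0 < α₀ → (geo9K (π i)).M * α₀ ≤ a₁ →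
      ∀ U : (bgT3 (π i)).Cfg, (bgT3 (π i)).Reg335 c35 α₀ U → (bgT3 (π i)).Reg336 c35 α₀ U →
        IsTransposePair ((𝔬 i).GG U) ((𝔬 i).GG U) ∧ IsTransposePair ((𝔬 i).D U ∘ₗ (𝔬 i).GG U) ((𝔬 i).GG U ∘ₗ (𝔬 i).Dstar U))
    (hl2N : ∀ (i : J) (U : (bgT3 (π i)).Cfg),
      L2ReadsNbr (R := (1 : ℝ)) (H := H₀ i) (GG i) 0 U (RelB (π i)) r Cev (𝔬 i).blk (𝔬 i).blk (ev i) ((𝔬 i).GG U) ∧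
      L2ReadsNbr (R := (1 : ℝ)) (H := H₀ i) (GG i) 1 U (RelB (π i)) r Cev (𝔬 i).blkY (𝔬 i).blk (ev i) ((𝔬 i).D U ∘ₗ (𝔬 i).GG U) ∧
      L2ReadsNbr (R := (1 : ℝ)) (H := H₀ i) (GG i) 2 U (RelB (π i)) r Cev (𝔬 i).blk (𝔬 i).blkY (evY i) ((𝔬 i).GG U ∘ₗ (𝔬 i).Dstar U) ∧
      L2ReadsNbr (R := (1 : ℝ)) (H := H₀ i) (GG i) 3 U (RelB (π i)) r Cev ((𝔬 i).blk ∘ Prod.fst) (𝔬 i).blk (ev i)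
        (familyOp (fun q : P × P => Dd i U q.1 ∘ₗ ((𝔬 i).GG U ∘ₗ Dds i U q.2))) ∧
      L2ReadsNbr (R := (1 : ℝ)) (H := H₀ i) (GG i) 4 U (RelB (π i)) r Cev ((𝔬 i).blk ∘ Prod.fst) (𝔬 i).blk (ev i)
        (familyOp (fun q : P × P => (Dd i U q.1 ∘ₗ Dd i U q.2) ∘ₗ (𝔬 i).GG U)) ∧
      L2ReadsNbr (R := (1 : ℝ)) (H := H₀ i) (GG i) 5 U (RelB (π i)) r Cev ((𝔬 i).blk ∘ Prod.fst) (𝔬 i).blk (ev i)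
        (familyOp (fun q : P × P => (𝔬 i).GG U ∘ₗ (Dds i U q.1 ∘ₗ Dds i U q.2))))
    (hH1N : ∀ (i : J) (U : (bgT3 (π i)).Cfg),
      H1ReadsNbr (GG i) U (𝔭 i) (RelB (π i)) r (𝔬 i).blk (𝔬 i).blkY (ev i) (evY i) ((𝔬 i).D U ∘ₗ (𝔬 i).GG U)
        ((𝔬 i).GG U ∘ₗ (𝔬 i).Dstar U))
    (hIF : ∀ (i : J) (U : (bgT3 (π i)).Cfg),
      InputReadsFam (GG i) U (bHX i) r ((𝔬 i).blk ∘ Prod.fst) ((𝔭 i).blkPX ∘ Prod.fst) (fun β => sliceProbe ((𝔭 i).ΦX U β)) (ev i)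
        (familyOp (fun q : P × P => Dd i U q.1 ∘ₗ ((𝔬 i).GG U ∘ₗ Dds i U q.2))))
    (hmodel : ∀ i : J, M₁ ≤ (geo9K (π i)).M → ∀ α₀ : ℝ, 0 < α₀ → (geo9K (π i)).M * α₀ ≤ a₁ →
      ∀ U : (bgT3 (π i)).Cfg, (bgT3 (π i)).Reg335 c35 α₀ U → (bgT3 (π i)).Reg336 c35 α₀ U →
        Thm33G0 (𝔬 i) 1 (H₀ i) B₀ δ₀ U ∧
        Step (𝔬 i) 1 (H₀ i) (geoOK_geo9K (π i)).lenle 1 (θ₁ * ((geo9K (π i)).M * α₀)) δK U ∧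
        Step (𝔬 i) 1 (H₀ i) (geoOK_geo9K (π i)).lenle 2 (θ₁ * ((geo9K (π i)).M * α₀)) δK U ∧
        FormSmall (𝔬 i) (r₁ * ((geo9K (π i)).M * α₀)) U ∧ Identities (𝔬 i) U)
    (hleft : ∀ i : J, M₁ ≤ (geo9K (π i)).M → ∀ α₀ : ℝ, 0 < α₀ → (geo9K (π i)).M * α₀ ≤ a₁ →
      ∀ U : (bgT3 (π i)).Cfg, (bgT3 (π i)).Reg335 c35 α₀ U → (bgT3 (π i)).Reg336 c35 α₀ U →
        LeftStep (𝔬 i) 1 (H₀ i) (geoOK_geo9K (π i)).lenle B₀ δ₀ (θD * ((geo9K (π i)).M * α₀)) δK U)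
    (wZ : ∀ i : J, (geo9K (π i)).Site → ℝ) (hwZ : ∀ i y, 0 < wZ i y)
    (hletters : ∀ i : J, M₁ ≤ (geo9K (π i)).M → ∀ α₀ : ℝ, 0 < α₀ → (geo9K (π i)).M * α₀ ≤ a₁ →
      ∀ U : (bgT3 (π i)).Cfg, (bgT3 (π i)).Reg335 c35 α₀ U → (bgT3 (π i)).Reg336 c35 α₀ U →
        Letters313Zc (𝔬 i) (Gp i) 1 (H₀ i) (geoOK_geo9K (π i)) (wZ i) (hwZ i) B₃ δ₃ (bXH i) U)
    (h152 : ∀ i : J, M₁ ≤ (geo9K (π i)).M → ∀ α₀ : ℝ, 0 < α₀ → (geo9K (π i)).M * α₀ ≤ a₁ →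
      ∀ U : (bgT3 (π i)).Cfg, (bgT3 (π i)).Reg335 c35 α₀ U → (bgT3 (π i)).Reg336 c35 α₀ U → Ids3152 (𝔬 i) (Gp i) U)
    (hlettersD : ∀ i : J, M₁ ≤ (geo9K (π i)).M → ∀ α₀ : ℝ, 0 < α₀ → (geo9K (π i)).M * α₀ ≤ a₁ →
      ∀ U : (bgT3 (π i)).Cfg, (bgT3 (π i)).Reg335 c35 α₀ U → (bgT3 (π i)).Reg336 c35 α₀ U →
        Letters313DZ (𝔬 i) 1 (H₀ i) (geoOK_geo9K (π i)) (wZ i) (hwZ i) B₃ δ₃ (bH i) U ∧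
          Letters313DMZ (𝔬 i) (𝔭 i) (Dd i) 1 (H₀ i) (geoOK_geo9K (π i)) (wZ i) (hwZ i) B₃ Bq δ₃ (bH i) U)
    (hG0C : ∀ i : J, M₁ ≤ (geo9K (π i)).M → ∀ α₀ : ℝ, 0 < α₀ → (geo9K (π i)).M * α₀ ≤ a₁ →
      ∀ U : (bgT3 (π i)).Cfg, (bgT3 (π i)).Reg335 c35 α₀ U → (bgT3 (π i)).Reg336 c35 α₀ U →
        Thm33G0Dir (𝔬 i) (𝔭 i) (Dd i) (Dds i) 1 (H₀ i) (bHX i) B₀ Bh Bi Bi2 δ₀ U ∧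
          Thm33G0DirR (𝔬 i) (Dds i) 1 (H₀ i) B₀ δ₀ U)
    (hstepD : ∀ i : J, M₁ ≤ (geo9K (π i)).M → ∀ α₀ : ℝ, 0 < α₀ → (geo9K (π i)).M * α₀ ≤ a₁ →
      ∀ U : (bgT3 (π i)).Cfg, (bgT3 (π i)).Reg335 c35 α₀ U → (bgT3 (π i)).Reg336 c35 α₀ U →
        StepDirB (𝔬 i) (𝔭 i) (Dd i) (Dds i) 1 (H₀ i) (bHX i) (geoOK_geo9K (π i)).lenle (θD * ((geo9K (π i)).M * α₀))
          (fun β => θH β * ((geo9K (π i)).M * α₀)) (fun ε => θI ε * ((geo9K (π i)).M * α₀)) δK U)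
    (hLHH : ∀ i : J, M₁ ≤ (geo9K (π i)).M → ∀ α₀ : ℝ, 0 < α₀ → (geo9K (π i)).M * α₀ ≤ a₁ →
      ∀ U : (bgT3 (π i)).Cfg, (bgT3 (π i)).Reg335 c35 α₀ U → (bgT3 (π i)).Reg336 c35 α₀ U →
        LettersHHZ (𝔬 i) (𝔭 i) 1 (H₀ i) (geoOK_geo9K (π i)).lenle
          (weightNorm (BlockNorm.ofBlocks (toB6 (geo9K (π i)) 1 (H₀ i)) (𝔬 i).blkZ) (wZ i) fun y => (hwZ i y).le) Bq δ₃ U)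
    (hLH3 : ∀ i : J, M₁ ≤ (geo9K (π i)).M → ∀ α₀ : ℝ, 0 < α₀ → (geo9K (π i)).M * α₀ ≤ a₁ →
      ∀ U : (bgT3 (π i)).Cfg, (bgT3 (π i)).Reg335 c35 α₀ U → (bgT3 (π i)).Reg336 c35 α₀ U →
        Letters313HZc (𝔬 i) (𝔭 i) (Gp i) 1 (H₀ i) (geoOK_geo9K (π i)) (wZ i) (hwZ i) (bH i) BhD Bx δ₃ (bXH i) U)
    (hG0L2 : ∀ i : J, M₁ ≤ (geo9K (π i)).M → ∀ α₀ : ℝ, 0 < α₀ → (geo9K (π i)).M * α₀ ≤ a₁ →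
      ∀ U : (bgT3 (π i)).Cfg, (bgT3 (π i)).Reg335 c35 α₀ U → (bgT3 (π i)).Reg336 c35 α₀ U →
        Thm33G0L2M (𝔬 i) (Dd i) (Dds i) 1 (H₀ i) B₂ δ₀ U)
    (hstepL2 : ∀ i : J, M₁ ≤ (geo9K (π i)).M → ∀ α₀ : ℝ, 0 < α₀ → (geo9K (π i)).M * α₀ ≤ a₁ →
      ∀ U : (bgT3 (π i)).Cfg, (bgT3 (π i)).Reg335 c35 α₀ U → (bgT3 (π i)).Reg336 c35 α₀ U →
        StepL2 (𝔬 i) 1 (H₀ i) (θ₂ * ((geo9K (π i)).M * α₀)) δK U)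
    (vZ : ∀ i : J, (geo9K (π i)).Site → ℝ) (hvZ : ∀ i y, 0 < vZ i y)
    (hLL2 : ∀ i : J, M₁ ≤ (geo9K (π i)).M → ∀ α₀ : ℝ, 0 < α₀ → (geo9K (π i)).M * α₀ ≤ a₁ →
      ∀ U : (bgT3 (π i)).Cfg, (bgT3 (π i)).Reg335 c35 α₀ U → (bgT3 (π i)).Reg336 c35 α₀ U →
        Letters313L2Pc (𝔬 i) (Dd i) (Dds i) 1 (H₀ i) B₄ δ₃ (vZ i) (hvZ i) U ∧
          Letters313L2MZ (𝔬 i) (Dd i) (Dds i) 1 (H₀ i) B₄ δ₃ (vZ i) (hvZ i) U)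
    (hLIM : ∀ i : J, M₁ ≤ (geo9K (π i)).M → ∀ α₀ : ℝ, 0 < α₀ → (geo9K (π i)).M * α₀ ≤ a₁ →
      ∀ U : (bgT3 (π i)).Cfg, (bgT3 (π i)).Reg335 c35 α₀ U → (bgT3 (π i)).Reg336 c35 α₀ U →
        Letters313IMB (𝔬 i) (𝔭 i) (Dd i) (Dds i) 1 (H₀ i) (geoOK_geo9K (π i)).lenle (bHX i) (bHW i) Br (fun ε => θV ε * ((geo9K (π i)).M * α₀))
          Bd Bd2 δ₃ δK U)
    (HasRWExp : ∀ i : J, B9.KernelFamily (geo9K (π i)) (bgT3 (π i)) → (bgT3 (π i)).Cfg → ℝ → Prop)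
    (PosDefK : ∀ i : J, B9.KernelFamily (geo9K (π i)) (bgT3 (π i)) → (bgT3 (π i)).Cfg → Prop)
    (hpinE : ∀ i : J, HasRWExp i = HasRWExpOfOps (𝔬 i)) (hpinK : ∀ i : J, PosDefK i = PosDefKOfOps (𝔬 i)) :
    B9.Thm313Printed c35 (fun i : J => geo9K (π i)) (fun i : J => bgT3 (π i)) GG HasRWExp PosDefK := by
  classical
  have hE : HasRWExp = fun i => HasRWExpOfOps (𝔬 i) := funext hpinE
  have hK : PosDefK = fun i => PosDefKOfOps (𝔬 i) := funext hpinK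
  rw [hE, hK]
  -- the floor: neighbour counts need `M ≥ M_nbr`, the length comparison needs `r < M`
  obtain ⟨Mnbr, mN, hnbrF⟩ := hnbr_geo9K_floor_fam π r
  set Mstar : ℝ := max Mnbr (r + 1) with hMstar
  have hrM : r < Mstar := lt_of_lt_of_le (lt_add_one r) (le_max_right _ _)
  let Sub : Type := {i : J // Mstar ≤ (geo9K (π i)).M}
  have hnbrSub : ∀ (j : Sub) (y : (geo9K (π j.1)).Site), (nbr (geo9K (π j.1)) r y).card ≤ mN :=
    fun j y => hnbrF ⟨j.1, (le_max_left _ _).trans j.2⟩ y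
  -- the generic row sum (2.61) at rate `σ`, Lemma 2.1 above threshold at exponent `α`, both restricted to the floor subtype
  obtain ⟨ML, c, hrow⟩ := rowSum261_geo9K (d := 2) (ℓ := ℓ) (hd := hd3) (hL := hL) (b₀ := b₀) (b₁ := b₁) σ hσ
  have hL21sub : ∀ δ : ℝ, 0 < δ → ∃ ML' c' : ℝ, Lemma21AboveG (fun j : Sub => geo9K (π j.1)) (fun _ => (1 : ℝ)) (fun j => H₀ j.1) δ α ML' c' := by
    intro δ hδ
    obtain ⟨ML', c', h⟩ := lemma21AboveG_geo9K_fam π H₀ hα0 hα1 δ hδ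
    exact ⟨ML', c', fun j hM => h j.1 hM⟩
  have hL1c : 1 ≤ (((ℓ + 1 : ℕ) : ℝ)) := by exact_mod_cast Nat.succ_le_succ (Nat.zero_le ℓ)
  refine thm313Printed_of_floor (geo := fun i : J => geo9K (π i)) (bg := fun i : J => bgT3 (π i)) Mstar ?_
  exact thm313Printed_completePairMBZc (geo := fun j : Sub => geo9K (π j.1)) (bg := fun j : Sub => bgT3 (π j.1))
      (fun j => 𝔬 j.1) (fun _ => 1) (fun j => H₀ j.1) (fun j => GG j.1) (fun j => bH j.1) (fun j => 𝔭 j.1) (fun j => bHX j.1) (fun j => Gp j.1) (fun j => bXH j.1) (fun j => Dd j.1) (fun j => Dds j.1)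
      (fun j => bHW j.1) (fun j => ev j.1) (fun j => evY j.1) (fun j => RelB (π j.1)) (2 * (2 + 1)) mN
      r Cev (((ℓ + 1 : ℕ) : ℝ)) θ₁ θD θ₂ r₁ B₀ B₂ B₄ δ₀ δK σ (max c 0) ρ a₁ M₁ ML B₃ δ₃ ρ' α (((ℓ + 1 : ℕ) : ℝ)) κ₀ Bh Bi Bq BhD Bx Bd θH θI θV Br Bi2 Bd2
      hθ₁ hθD hθH hθI hθ₂ hθV hr₁ hB₀ hB₂ hB₃ hB₄ hBr hσ.le hρ' hρ'ρ hρ'ρ₅ hσρ' hρS hρ₃ hρδ (le_max_right _ _) ha₁ hM₁ hα0.le hBi hBd hBi2 hBd2 hBh hBq hBhD hBx hCev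
      hL1c (fun j => geoOK_geo9K (π j.1)) (fun j => modelSignsOn_geo9K (π j.1)) (fun j => geo9K_one_le_L (π j.1)) (fun j => geo9K_L_le (π j.1)) (fun j => geo9K_eta_pos (π j.1))
      (fun j => hκ j.1) (fun j ε => hκW j.1 ε) (fun j => hκX j.1) (fun j hM y => (hrow (π j.1) hM y).trans (le_max_left _ _)) hL21sub hnbrSub
      (fun j a a' h => hCL_geo9K_floor_fam π hrM j a a' h)
      (fun j n B' δ' => ⟨fun a a' b h => maj342_relB_left (π j.1) n B' δ' a a' b h, fun a b b' h => maj342_relB_right (π j.1) n B' δ' a b b' h⟩)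
      (fun j y' => card_filter_relB_le (π j.1) y') (fun j U => hcoR j.1 U) (fun j U => hco1R j.1 U) (fun j U => hcoG j.1 U)
      (fun j hM α₀ hα₀ hMa U hU hU' => hsymGG j.1 hM α₀ hα₀ hMa U hU hU') (fun j U => hl2N j.1 U) (fun j U => hH1N j.1 U) (fun j U => hIF j.1 U)
      (fun j a a' b h => dist_eq_of_relB (π j.1) h (relB_refl (π j.1) b))
      (fun j hM α₀ hα₀ hMa U hU hU' => hmodel j.1 hM α₀ hα₀ hMa U hU hU') (fun j hM α₀ hα₀ hMa U hU hU' => hleft j.1 hM α₀ hα₀ hMa U hU hU')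
      (fun j => wZ j.1) (fun j y => hwZ j.1 y) (fun j hM α₀ hα₀ hMa U hU hU' => hletters j.1 hM α₀ hα₀ hMa U hU hU')
      (fun j hM α₀ hα₀ hMa U hU hU' => h152 j.1 hM α₀ hα₀ hMa U hU hU')
      (fun j hM α₀ hα₀ hMa U hU hU' => hlettersD j.1 hM α₀ hα₀ hMa U hU hU') (fun j hM α₀ hα₀ hMa U hU hU' => hG0C j.1 hM α₀ hα₀ hMa U hU hU')
      (fun j hM α₀ hα₀ hMa U hU hU' => hstepD j.1 hM α₀ hα₀ hMa U hU hU') (fun j hM α₀ hα₀ hMa U hU hU' => hLHH j.1 hM α₀ hα₀ hMa U hU hU')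
      (fun j hM α₀ hα₀ hMa U hU hU' => hLH3 j.1 hM α₀ hα₀ hMa U hU hU') (fun j hM α₀ hα₀ hMa U hU hU' => hG0L2 j.1 hM α₀ hα₀ hMa U hU hU')
      (fun j hM α₀ hα₀ hMa U hU hU' => hstepL2 j.1 hM α₀ hα₀ hMa U hU hU') (fun j => vZ j.1) (fun j y => hvZ j.1 y)
      (fun j hM α₀ hα₀ hMa U hU hU' => hLL2 j.1 hM α₀ hα₀ hMa U hU hU') (fun j hM α₀ hα₀ hMa U hU hU' => hLIM j.1 hM α₀ hα₀ hMa U hU hU')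

end Summit.QuantumFields.YangMills.Theorems.Prop7SectET3N06LeavesRecordCutFam

end
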